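import Summits.RiemannHypothesis.RiemannHypothesis.Theorems.WeilParityEvenWinsBeyondArchFrontierCell7OfBlocks
import Summits.RiemannHypothesis.RiemannHypothesis.Theorems.GroundBartaEvenWinsBeyondArchUpper83Sharp
import HarnessLib

/-!
# RiemannHypothesis / GroundBarta — rung 4: CELL 8 `[83/100, c₂]` of the parity ladder from the landed U-side at `83/100` and ONE odd
# lower bound at its right end `c₂` (to be placed; `c₂ ≤ (log 7)/2`)

Helper file (`--supports stmt-RiemannHypothesis-18085`), RH-free, pure logic (prover B g8; the cell template of prover A g11's
`…FrontierCell7OfBlocks`, one cell further, with the right end `c₂` left symbolic).  The U-side of cell 8 is in the tree: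
`trialUpper83sharp : ε(83/100) ≤ 483·10⁻²¹` (`…Upper83Sharp`, prover B g8, from the first even Ritz vector of the `83/100` cell).  Hence:

* `weilWindowSimpleEven_on_cell8_of_oddLower` — for ANY `c₂ ≥ 83/100`, an odd lower bound `483·10⁻²¹ < L ≤ ε_od(c₂)` gives
  `WeilWindowSimpleEven a` on the whole cell `[83/100, c₂]`;
* `weilWindowSimpleEven_upTo_cell8_of_oddLowers` — together with cell 7's odd bound at `83/100` (`10⁻¹⁷ < L₇ ≤ ε_od(83/100)`, the `83/100` odd block)
  the ladder reaches `c₂`: `WeilWindowSimpleEven a` for every `0 < a ≤ c₂`; and the strict parity order there.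

Placement of `c₂` (planning data, kit j192030/j192501 of this unit, Ritz bottoms on `[0.84, 0.97]`): the odd block at `c₂` must certify
`λ_od > 4.83·10⁻¹⁹` while `λ_od` is a few per cent of `ε_od(c₂)`, i.e. `ε_od(c₂) ≳ 10⁻¹⁷` — see `CELL8-SCAN.md` of unit `sr-gb-rung-b`.
-/

set_option linter.dupNamespace false

noncomputable section

open Set MeasureTheory

namespace Summit.RiemannHypothesis.RiemannHypothesis.Theorems.EvenWinsBeyondArch

open Literature.NumberTheory.LFunctions

/-- **Cell 8 `[83/100, c₂]`**: `483·10⁻²¹ < L ≤ ε_od(c₂) ⟹ WeilWindowSimpleEven a` for `a ∈ [83/100, c₂]` (U-side `trialUpper83sharp`). [folklore] -/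
theorem weilWindowSimpleEven_on_cell8_of_oddLower {c₂ L : ℝ} (hUL : (483 / 1000000000000000000000 : ℝ) < L)
    (hL : L ≤ weilOddGroundEnergy c₂) {a : ℝ} (hlo : (83 / 100 : ℝ) ≤ a) (hhi : a ≤ c₂) :
    WeilWindowSimpleEven a :=
  GroundStateSimpleEven.weilWindowSimpleEven_on_cell_of_le (b := (83 / 100 : ℝ)) (c := c₂) (by norm_num) hUL
    trialUpper83sharp (fun _ hg hs hn ho ↦ hL.trans (weilOddGroundEnergy_le hg hs ho hn)) hlo hhi

/-- **The ladder up to `c₂`** from the two odd bounds (cell 7 at `83/100`, cell 8 at `c₂`): `WeilWindowSimpleEven a` for every `0 < a ≤ c₂`.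
[folklore] -/
theorem weilWindowSimpleEven_upTo_cell8_of_oddLowers {c₂ L₇ L₈ : ℝ}
    (hUL₇ : (1 / 100000000000000000 : ℝ) < L₇) (hL₇ : L₇ ≤ weilOddGroundEnergy (83 / 100))
    (hUL₈ : (483 / 1000000000000000000000 : ℝ) < L₈) (hL₈ : L₈ ≤ weilOddGroundEnergy c₂) :
    ∀ a : ℝ, 0 < a → a ≤ c₂ → WeilWindowSimpleEven a := by
  intro a ha hle
  rcases le_or_gt a (83 / 100) with h | h
  · exact weilWindowSimpleEven_upTo_83_of_oddLower hUL₇ hL₇ a ha h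
  · exact weilWindowSimpleEven_on_cell8_of_oddLower hUL₈ hL₈ h.le hle

/-- **Strict parity order up to `c₂`** from the two odd bounds: `ε_ev(a) < ε_od(a)` for `0 < a ≤ c₂`. [folklore] -/
theorem weilEvenGroundEnergy_lt_weilOddGroundEnergy_upTo_cell8_of_oddLowers {c₂ L₇ L₈ : ℝ}
    (hUL₇ : (1 / 100000000000000000 : ℝ) < L₇) (hL₇ : L₇ ≤ weilOddGroundEnergy (83 / 100))
    (hUL₈ : (483 / 1000000000000000000000 : ℝ) < L₈) (hL₈ : L₈ ≤ weilOddGroundEnergy c₂) {a : ℝ} (ha : 0 < a) (hle : a ≤ c₂) :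
    weilEvenGroundEnergy a < weilOddGroundEnergy a :=
  (weilWindowSimpleEven_iff_weilEvenGroundEnergy_lt ha).1 (weilWindowSimpleEven_upTo_cell8_of_oddLowers hUL₇ hL₇ hUL₈ hL₈ a ha hle)

/-- Tail shape of item 18085 up to `c₂` (windows beyond `log 2`), from the two odd bounds. [folklore] -/
theorem tailSimpleEven_upTo_cell8_of_oddLowers {c₂ L₇ L₈ : ℝ}
    (hUL₇ : (1 / 100000000000000000 : ℝ) < L₇) (hL₇ : L₇ ≤ weilOddGroundEnergy (83 / 100))
    (hUL₈ : (483 / 1000000000000000000000 : ℝ) < L₈) (hL₈ : L₈ ≤ weilOddGroundEnergy c₂) :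
    ∀ a : ℝ, Real.log 2 < a → a ≤ c₂ → WeilWindowSimpleEven a :=
  fun a ha hle ↦ weilWindowSimpleEven_upTo_cell8_of_oddLowers hUL₇ hL₇ hUL₈ hL₈ a ((Real.log_pos (by norm_num)).trans ha) hle

end Summit.RiemannHypothesis.RiemannHypothesis.Theorems.EvenWinsBeyondArch

end
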